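import Summits.QuantumFields.BalabanUV.Beta.FP.StationarityJ

/-!
# `BalabanUV.Beta.FP.StationarityW` — road «FP» for binder row D1, leaf N1-J (FINITE LEVEL), SECOND-ORDER TWIN: the DECIMATED
# one-shot second-order vertex family of a fine bi-stencil family read on the step-`j` lattice, and its EXACT NESTING under one more
# blocking step — one more decimation of the fluctuation legs COMPOSED WITH the transport of BOTH bond indices through the one-step
# minimiser response ((K1b′ ⊗ K1b′), `BalabanCompositeJets.vertex2Of_pow_succ` BY NAME)

HONEST FRAMING (cell contract, verbatim): «discharging `BetaPertH` makes Bałaban's UV stability UNCONDITIONAL — a real constructive-QFT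
result; it is NOT the continuum limit and NOT the Clay problem.»  THIS MODULE DISCHARGES NOTHING: one definition-by-abbreviation over the
cell's typed objects (`OneStepKernelFamily.dec`, `BalabanCompositeJets.vertex2Of`) and absolutely-convergent-sum bookkeeping; the one
non-trivial input is an2's kernel theorem `BalabanCompositeJets.vertex2Of_pow_succ`, imported BY NAME.  Companion of `FP/StationarityJ`
(first-order twin `SDec_succ_level`); skeleton `HOME/beta/skeletons/D1-b2b-balaban-beta-d1-p3.md` §3 N1, claim table `LEAVES-FP.md` row N1-J
(unit `b2b-balaban-beta-d1-formalise-leaf-08`).  NOT BetaPertH, NOT continuum, NOT Clay.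
HONEST DEPENDENCY (verbatim): «continuum YM on T⁴ ⇐ BetaPertH ∧ nine spine estimates (0/9 proved); BetaPertH ⇐ (D1) ∧ (D4) ∧ CAP+tail;
G-an2-4 gates asym, D1 and NE2/3/4.»
ABSOLUTE RULE (cell, verbatim): «No internally-minted statement may enter as a cited fact. Every hypothesis is either kernel-proved in this
package or a verbatim quotation of a PUBLISHED theorem with page reference.»  Nothing is cited; no `def … : Prop`; no binder instantiated.

WHAT.  The composite system's second-order data contain (among the P4 pieces an2 keeps abstract) the `ℋ ⊗ ℋ`-transported fine second-order
tables: for a fine bi-stencil family `S₂ κ u κ′ u′` (`BalabanCompositeJets.LocStencil₂`), an2's `vertex2Of N S₂ μ z ν z′` reads both fine bond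
slots through the minimiser columns of the `N`-fold packed resolvent.  On the step-`j` lattice (the (j, m)-systems of road FP) the object is,
exactly as for the first-order family `StationarityJ.SDec`, the `j`-fold chain rule FOLLOWED by the decimation of the fluctuation legs:
  `WDec S₂ j μ y ν y′ := ((Lc^j)^{d+2})² • dec (Lc^j) (vertex2Of (Lc^j) S₂ μ y ν y′)`   (one `respStep_eq` normalisation per bond slot).
THE THEOREM `WDec_succ_level`: `WDec S₂ (j+1) μ y ν y′ = (Lc^{d+2})² • transportW (Lc^j) (respStep (Lc^j) (Lc^(j+1))) (decW Lc (WDec S₂ j)) μ y ν y′`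
— one more decimation and the transport of BOTH bond indices by the one-step response (an2's `InterLevelTransport.transportW`).  The bi-stencil
family `S₂` is ARBITRARY (local): which `S₂` the composite step carries at total level `j + m` is an2's P4 node and is not decided here (so the
(j, m)-indexing of `StationarityJ.SDec` is left to the instantiation `S₂ := S₂fam (j + m)`).
CONTENT ([folklore]/[our object]): §1 `dec_transportW` (decimation through the double transport superposition, under summability), `transportW_smul`,
`decW`; §2 summability of the double superposition for `𝒲 = vertex2Of M S₂` (`summable_respStep` × the uniform entry bound of
`vertexFamily₂_vertex2Of'`; inner sums bounded by `Σ'|respStep|·C`); §3 `WDec`, `WDec_succ_level`.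
NOT DONE: the limit `j → ∞`; the other P4 pieces (second response of the minimiser × first-order stencils, lifted step second jets).
-/

namespace Summit.QuantumFields.BalabanUV.Beta.FP.StationarityW

open Finset
open scoped BigOperators
open Literature.MathematicalPhysics.QuantumFieldTheory.Balaban1983to89
open Literature.MathematicalPhysics.QuantumFieldTheory.Balaban1983to89.Beta
open Literature.MathematicalPhysics.QuantumFieldTheory.Balaban1983to89.B12Sec2to5 (l1 l1_nonneg)
open ExpKernelCalculus (MKer BiLoc VertexFamily₂)
open OneStepResolventKernel (Fib)
open OneStepKernelFamily (dec)
open InterLevelTransport (cwsum cwsum_apply transportW)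
open BalabanCompositeJets (LocStencil₂ vertex2Of respStep summable_respStep vertex2Of_pow_succ vertexFamily₂_vertex2Of')
open Summit.QuantumFields.BalabanUV.Beta.GAN24.ScaleNesting (dec_dec')
open Summit.QuantumFields.BalabanUV.Beta.FP.StationarityJ (dec_smul dec_fun_sum dec_cwsum)

variable {d : ℕ}

/-! ## §1 Decimation through the double transport; decimated table families -/

section DecW

/-- [folklore] **DECIMATION COMMUTES WITH THE DOUBLE RESPONSE TRANSPORT** `transportW` (both superpositions absolutely convergent). -/
theorem dec_transportW {N : ℕ} [NeZero N] (M : ℕ) {R : Fin (d + 1) → (Fin (d + 1) → ℤ) → Fin (d + 1) → (Fin (d + 1) → ℤ) → ℝ}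
    {𝒲 : Fin (d + 1) → (Fin (d + 1) → ℤ) → Fin (d + 1) → (Fin (d + 1) → ℤ) → MKer (d + 1) (Fib d)}
    (hin : ∀ ν z' ν' μ' y' p q a b, Summable fun y'' => R ν z' ν' y'' * 𝒲 μ' y' ν' y'' p q a b)
    (hout : ∀ μ z μ' ν z' ν' p q a b,
      Summable fun y' => R μ z μ' y' * cwsum N (fun y'' => R ν z' ν' y'') (fun y'' => 𝒲 μ' y' ν' y'') p q a b)
    (μ : Fin (d + 1)) (z : Fin (d + 1) → ℤ) (ν : Fin (d + 1)) (z' : Fin (d + 1) → ℤ) :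
    dec M (transportW N R 𝒲 μ z ν z') = transportW N R (fun μ' y' ν' y'' => dec M (𝒲 μ' y' ν' y'')) μ z ν z' := by
  have e : transportW N R 𝒲 μ z ν z' = fun x w a b => ∑ p ∈ (Finset.univ : Finset (Fin (d + 1) × Fin (d + 1))),
      cwsum N (fun y' => R μ z p.1 y') (fun y' => cwsum N (fun y'' => R ν z' p.2 y'') (fun y'' => 𝒲 p.1 y' p.2 y'')) x w a b := by
    funext x w a b
    rw [← Finset.univ_product_univ, Finset.sum_product]
    rfl
  rw [e, dec_fun_sum]
  funext x w a b
  rw [show transportW N R (fun μ' y' ν' y'' => dec M (𝒲 μ' y' ν' y'')) μ z ν z' x w a b =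
      ∑ p ∈ (Finset.univ : Finset (Fin (d + 1) × Fin (d + 1))), cwsum N (fun y' => R μ z p.1 y')
        (fun y' => cwsum N (fun y'' => R ν z' p.2 y'') (fun y'' => dec M (𝒲 p.1 y' p.2 y''))) x w a b by
    rw [← Finset.univ_product_univ, Finset.sum_product]; rfl]
  refine Finset.sum_congr rfl fun p _ => ?_
  rw [dec_cwsum M (hout μ z p.1 ν z' p.2)]
  congr 1
  funext y'
  exact dec_cwsum M (hin ν z' p.2 p.1 y')

/-- [folklore] The double transport is linear in the transported family (scalars). -/
theorem transportW_smul {N : ℕ} [NeZero N] (R : Fin (d + 1) → (Fin (d + 1) → ℤ) → Fin (d + 1) → (Fin (d + 1) → ℤ) → ℝ) (c : ℝ)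
    (𝒲 : Fin (d + 1) → (Fin (d + 1) → ℤ) → Fin (d + 1) → (Fin (d + 1) → ℤ) → MKer (d + 1) (Fib d))
    (μ : Fin (d + 1)) (z : Fin (d + 1) → ℤ) (ν : Fin (d + 1)) (z' : Fin (d + 1) → ℤ) :
    transportW N R (fun μ' y' ν' y'' => c • 𝒲 μ' y' ν' y'') μ z ν z' = c • transportW N R 𝒲 μ z ν z' := by
  funext x w a b
  show ∑ μ' : Fin (d + 1), ∑ ν' : Fin (d + 1), cwsum N (fun y' => R μ z μ' y')
      (fun y' => cwsum N (fun y'' => R ν z' ν' y'') (fun y'' => c • 𝒲 μ' y' ν' y'')) x w a b =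
    c * ∑ μ' : Fin (d + 1), ∑ ν' : Fin (d + 1), cwsum N (fun y' => R μ z μ' y')
      (fun y' => cwsum N (fun y'' => R ν z' ν' y'') (fun y'' => 𝒲 μ' y' ν' y'')) x w a b
  rw [Finset.mul_sum]
  refine Finset.sum_congr rfl fun μ' _ => ?_
  rw [Finset.mul_sum]
  refine Finset.sum_congr rfl fun ν' _ => ?_
  rw [cwsum_apply, cwsum_apply, ← tsum_mul_left]
  refine tsum_congr fun y' => ?_
  have hin : cwsum N (fun y'' => R ν z' ν' y'') (fun y'' => c • 𝒲 μ' y' ν' y'') x w a b =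
      c * cwsum N (fun y'' => R ν z' ν' y'') (fun y'' => 𝒲 μ' y' ν' y'') x w a b := by
    rw [cwsum_apply, cwsum_apply, ← tsum_mul_left]
    exact tsum_congr fun y'' => by simp only [Pi.smul_apply, smul_eq_mul]; ring
  rw [hin]
  ring

/-- [our object] Decimation of every member of a second-order table family (bond indices untouched). -/
noncomputable def decW (M : ℕ) (W : Fin (d + 1) → (Fin (d + 1) → ℤ) → Fin (d + 1) → (Fin (d + 1) → ℤ) → MKer (d + 1) (Fib d)) :
    Fin (d + 1) → (Fin (d + 1) → ℤ) → Fin (d + 1) → (Fin (d + 1) → ℤ) → MKer (d + 1) (Fib d) :=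
  fun μ y ν y' => dec M (W μ y ν y')

/-- [our object] Unfolding. -/
@[simp] theorem decW_apply (M : ℕ) (W : Fin (d + 1) → (Fin (d + 1) → ℤ) → Fin (d + 1) → (Fin (d + 1) → ℤ) → MKer (d + 1) (Fib d))
    (μ : Fin (d + 1)) (y : Fin (d + 1) → ℤ) (ν : Fin (d + 1)) (y' : Fin (d + 1) → ℤ) : decW M W μ y ν y' = dec M (W μ y ν y') := rfl

/-- [folklore] Decimations of table families nest (`ScaleNesting.dec_dec'` memberwise). -/
theorem decW_decW {M P R : ℕ} (hR : R = M * P)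
    (W : Fin (d + 1) → (Fin (d + 1) → ℤ) → Fin (d + 1) → (Fin (d + 1) → ℤ) → MKer (d + 1) (Fib d)) :
    decW P (decW M W) = decW R W := by
  funext μ y ν y'
  exact dec_dec' hR (W μ y ν y')

end DecW

/-! ## §2 Summability of the double transport superposition of a one-shot second-order vertex family -/

section Summability

variable {S₂ : Fin (d + 1) → (Fin (d + 1) → ℤ) → Fin (d + 1) → (Fin (d + 1) → ℤ) → MKer (d + 1) (Fib d)} {C δ : ℝ}

/-- [folklore] A second-order vertex family has uniformly bounded entries. -/
theorem abs_apply_le_of_vertexFamily₂ {N : ℕ} {𝒲 : Fin (d + 1) → (Fin (d + 1) → ℤ) → Fin (d + 1) → (Fin (d + 1) → ℤ) → MKer (d + 1) (Fib d)}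
    {Cw δw : ℝ} (hW : VertexFamily₂ 𝒲 N Cw δw) (hδw : 0 < δw) (μ : Fin (d + 1)) (y : Fin (d + 1) → ℤ) (ν : Fin (d + 1))
    (y' x z : Fin (d + 1) → ℤ) (a b : Fib d) : |𝒲 μ y ν y' x z a b| ≤ Cw := by
  have hCw : 0 ≤ Cw := (hW μ y ν y').nonneg a
  refine (hW μ y ν y' x z a b).trans ?_
  have hexp : Real.exp (-δw * (l1 (x - (N : ℤ) • y) + l1 (z - (N : ℤ) • y'))) ≤ 1 := by
    rw [Real.exp_le_one_iff]
    have := l1_nonneg (x - (N : ℤ) • y)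
    have := l1_nonneg (z - (N : ℤ) • y')
    nlinarith
  calc Cw * Real.exp (-δw * (l1 (x - (N : ℤ) • y) + l1 (z - (N : ℤ) • y'))) ≤ Cw * 1 := mul_le_mul_of_nonneg_left hexp hCw
    _ = Cw := mul_one Cw

/-- [folklore] INNER superposition: `y″ ↦ respStep … y″ · vertex2Of M S₂ μ′ y′ ν′ y″ (entry)` is summable. -/
theorem summable_inner {M N' : ℕ} [NeZero M] [NeZero N'] (hS₂ : LocStencil₂ S₂ C δ) (hδ : 0 < δ)
    (ν : Fin (d + 1)) (z' : Fin (d + 1) → ℤ) (ν' μ' : Fin (d + 1)) (y' p q : Fin (d + 1) → ℤ) (a b : Fib d) :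
    Summable fun y'' => respStep (d := d) M N' ν z' ν' y'' * vertex2Of M S₂ μ' y' ν' y'' p q a b := by
  obtain ⟨Cw, δw, hδw, hW⟩ := vertexFamily₂_vertex2Of' (N := M) hS₂ hδ
  refine Summable.of_norm_bounded ((summable_respStep (d := d) M N' ν z' ν').norm.mul_right Cw) fun y'' => ?_
  rw [norm_mul, Real.norm_eq_abs, Real.norm_eq_abs]
  exact mul_le_mul_of_nonneg_left (abs_apply_le_of_vertexFamily₂ hW hδw μ' y' ν' y'' p q a b) (abs_nonneg _)

/-- [folklore] `|Σ' f| ≤ Σ' |f|` for a summable real family (`norm_tsum_le_tsum_norm`). -/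
theorem abs_tsum_le_tsum_abs {ι : Type*} {f : ι → ℝ} (hf : Summable f) : |∑' i, f i| ≤ ∑' i, |f i| := by
  have h := norm_tsum_le_tsum_norm (f := f) (by simpa only [Real.norm_eq_abs] using hf.abs)
  simpa only [Real.norm_eq_abs] using h

/-- [folklore] The inner superposition is bounded uniformly in the outer index: `|cwsum …| ≤ (Σ'|respStep|)·Cw`. -/
theorem abs_cwsum_inner_le {M N' N : ℕ} [NeZero M] [NeZero N'] [NeZero N] (hS₂ : LocStencil₂ S₂ C δ) (hδ : 0 < δ)
    {Cw δw : ℝ} (hW : VertexFamily₂ (vertex2Of M S₂) M Cw δw) (hδw : 0 < δw)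
    (ν : Fin (d + 1)) (z' : Fin (d + 1) → ℤ) (ν' μ' : Fin (d + 1)) (y' p q : Fin (d + 1) → ℤ) (a b : Fib d) :
    |cwsum N (fun y'' => respStep (d := d) M N' ν z' ν' y'') (fun y'' => vertex2Of M S₂ μ' y' ν' y'') p q a b| ≤
      (∑' y'', |respStep (d := d) M N' ν z' ν' y''|) * Cw := by
  rw [cwsum_apply]
  have hs := summable_inner (M := M) (N' := N') hS₂ hδ ν z' ν' μ' y' p q a b
  have habs : Summable fun y'' => |respStep (d := d) M N' ν z' ν' y''| := (summable_respStep (d := d) M N' ν z' ν').abs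
  calc |∑' y'', respStep (d := d) M N' ν z' ν' y'' * vertex2Of M S₂ μ' y' ν' y'' p q a b|
      ≤ ∑' y'', |respStep (d := d) M N' ν z' ν' y'' * vertex2Of M S₂ μ' y' ν' y'' p q a b| := abs_tsum_le_tsum_abs hs
    _ ≤ ∑' y'', |respStep (d := d) M N' ν z' ν' y''| * Cw := by
        refine Summable.tsum_le_tsum (fun y'' => ?_) hs.abs (habs.mul_right Cw)
        rw [abs_mul]
        exact mul_le_mul_of_nonneg_left (abs_apply_le_of_vertexFamily₂ hW hδw μ' y' ν' y'' p q a b) (abs_nonneg _)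
    _ = (∑' y'', |respStep (d := d) M N' ν z' ν' y''|) * Cw := tsum_mul_right

/-- [folklore] OUTER superposition: `y′ ↦ respStep … y′ · (inner cwsum at y′)(entry)` is summable (summable response × bounded inner sum). -/
theorem summable_outer {M N' N : ℕ} [NeZero M] [NeZero N'] [NeZero N] (hS₂ : LocStencil₂ S₂ C δ) (hδ : 0 < δ)
    (μ : Fin (d + 1)) (z : Fin (d + 1) → ℤ) (μ' ν : Fin (d + 1)) (z' : Fin (d + 1) → ℤ) (ν' : Fin (d + 1))
    (p q : Fin (d + 1) → ℤ) (a b : Fib d) :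
    Summable fun y' => respStep (d := d) M N' μ z μ' y' *
      cwsum N (fun y'' => respStep (d := d) M N' ν z' ν' y'') (fun y'' => vertex2Of M S₂ μ' y' ν' y'') p q a b := by
  obtain ⟨Cw, δw, hδw, hW⟩ := vertexFamily₂_vertex2Of' (N := M) hS₂ hδ
  set B : ℝ := (∑' y'', |respStep (d := d) M N' ν z' ν' y''|) * Cw
  refine Summable.of_norm_bounded ((summable_respStep (d := d) M N' μ z μ').norm.mul_right B) fun y' => ?_
  rw [norm_mul, Real.norm_eq_abs, Real.norm_eq_abs]
  exact mul_le_mul_of_nonneg_left (abs_cwsum_inner_le (N := N) hS₂ hδ hW hδw ν z' ν' μ' y' p q a b) (abs_nonneg _)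

end Summability

/-! ## §3 The decimated one-shot second-order family on the step-`j` lattice and its exact nesting -/

section Family

variable (Lc : ℕ) [NeZero Lc]

/-- [our object] **THE DECIMATED ONE-SHOT SECOND-ORDER VERTEX FAMILY** of a fine bi-stencil family `S₂`, read on the step-`j` lattice:
both fine bond slots driven through the `j`-fold minimiser (`vertex2Of (Lc^j)`), fluctuation legs decimated by `Lc^j`, normalisation
`((Lc^j)^{d+2})²` (one `respStep_eq` factor per slot). -/
noncomputable def WDec (S₂ : Fin (d + 1) → (Fin (d + 1) → ℤ) → Fin (d + 1) → (Fin (d + 1) → ℤ) → MKer (d + 1) (Fib d)) (j : ℕ) :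
    Fin (d + 1) → (Fin (d + 1) → ℤ) → Fin (d + 1) → (Fin (d + 1) → ℤ) → MKer (d + 1) (Fib d) :=
  fun μ y ν y' => ((((Lc ^ j : ℕ) : ℝ) ^ (d + 2)) ^ 2) • dec (Lc ^ j) (vertex2Of (Lc ^ j) S₂ μ y ν y')

variable {Lc}
variable {S₂ : Fin (d + 1) → (Fin (d + 1) → ℤ) → Fin (d + 1) → (Fin (d + 1) → ℤ) → MKer (d + 1) (Fib d)} {C δ : ℝ}

/-- [our object] Unfolding. -/
theorem WDec_apply (S₂ : Fin (d + 1) → (Fin (d + 1) → ℤ) → Fin (d + 1) → (Fin (d + 1) → ℤ) → MKer (d + 1) (Fib d)) (j : ℕ)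
    (μ : Fin (d + 1)) (y : Fin (d + 1) → ℤ) (ν : Fin (d + 1)) (y' : Fin (d + 1) → ℤ) :
    WDec Lc S₂ j μ y ν y' = ((((Lc ^ j : ℕ) : ℝ) ^ (d + 2)) ^ 2) • dec (Lc ^ j) (vertex2Of (Lc ^ j) S₂ μ y ν y') := rfl

/-- [folklore] **EXACT NESTING OF THE DECIMATED SECOND-ORDER VERTEX FAMILY** (the (K1b′ ⊗ K1b′) twin of `StationarityJ.SDec_succ_level`):
`WDec S₂ (j+1) μ y ν y′ = (Lc^{d+2})² • transportW (Lc^j) (respStep (Lc^j) (Lc^(j+1))) (decW Lc (WDec S₂ j)) μ y ν y′`. -/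
theorem WDec_succ_level (hS₂ : LocStencil₂ S₂ C δ) (hδ : 0 < δ) (j : ℕ) (μ : Fin (d + 1)) (y : Fin (d + 1) → ℤ) (ν : Fin (d + 1))
    (y' : Fin (d + 1) → ℤ) :
    WDec Lc S₂ (j + 1) μ y ν y' =
      (((Lc : ℝ) ^ (d + 2)) ^ 2) • transportW (Lc ^ j) (respStep (d := d) (Lc ^ j) (Lc ^ (j + 1))) (decW Lc (WDec Lc S₂ j)) μ y ν y' := by
  -- the right-hand side: one more decimation of each member, normalisation pulled through the double transport
  have hR : decW Lc (WDec Lc S₂ j) = fun μ' u' ν' u'' =>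
      ((((Lc ^ j : ℕ) : ℝ) ^ (d + 2)) ^ 2) • dec (Lc ^ (j + 1)) (vertex2Of (Lc ^ j) S₂ μ' u' ν' u'') := by
    funext μ' u' ν' u''
    rw [decW_apply, WDec_apply, dec_smul, dec_dec' (pow_succ Lc j)]
  rw [hR, transportW_smul, smul_smul]
  -- the left-hand side: (K1b′ ⊗ K1b′) at the vertex level, then decimation through the double transport
  rw [WDec_apply, vertex2Of_pow_succ Lc hS₂ hδ j μ y ν y',
    dec_transportW (Lc ^ (j + 1)) (fun ν z' ν' μ' y' p q a b => summable_inner hS₂ hδ ν z' ν' μ' y' p q a b)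
      (fun μ z μ' ν z' ν' p q a b => summable_outer hS₂ hδ μ z μ' ν z' ν' p q a b) μ y ν y']
  congr 1
  push_cast
  ring

end Family

end Summit.QuantumFields.BalabanUV.Beta.FP.StationarityW
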